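import Literature.MathematicalPhysics.QuantumFieldTheory.Balaban1983to89.Beta.ColourTrace

/-!
# `Balaban1983to89.Beta.ColourTraceAdjoint` — THE ADJOINT COLOUR MATRICES IN BAŁABAN'S LETTERS: the letter-basis reading of
`ad t_c = [t_c, ·]` as `ColourTrace.adMatC τ (τ c)`, the vanishing of `tr_C(ad X)` for every `X`, and the named colour weights
`tr_C(ad t_{c′} · ad t_c) = −[c = c′]·2N²` (the direct order being `ColourTrace.trace_adMatC_gen`), `tr_C(ad[t_c,t_{c′}]) = 0`
that a colour-blind one-loop contraction against the TRUE
(coloured) step vertices consumes (β sub-cell of `pub-balaban`, row BETA-lit1 = the transfer / normalisation / colour-dictionary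
seat, gen 20; written on the an2 lineage's FINDING F-an2g8-1 (cell journal 2026-08-19T14:11Z, item (F2) «COLOUR-STRIPPING
CONVENTION»: the true first-order vertex in colour direction `c` is `S ⊗ ad t_c`, the packed resolvent is colour-blind, so the
bubble carries ONE real weight `tr_C(ad t_c ad t_{c′})` and each tadpole block `W_i ⊗ C_i` the weight `tr_C(C_i)`,
`C_i ∈ {ad t_c·ad t_{c′}, ad t_{c′}·ad t_c, ad[t_c,t_{c′}], …}»).

HONEST FRAMING (cell rule, verbatim): discharging `BetaPertH` makes Bałaban's UV stability UNCONDITIONAL — a real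
constructive-QFT result; it is NOT the continuum limit and NOT the Clay problem.  THIS MODULE DISCHARGES NOTHING of the series
and instantiates no binder of the wall; it asserts no VALUE of any weight of Bałaban's kernel (which colour matrix multiplies
which colourless table is the an2/an3 lineages' derivation).  It is finite-dimensional linear algebra over an arbitrary
generator family: a kernel-checked DICTIONARY so that a consumer cites ONE theorem per colour weight.  NOT summit progress.

ABSOLUTE RULE (cell charter, verbatim in substance).  No internally-minted statement enters as a cited fact: every hypothesis
below is one of the family predicates `ColourTrace.Complete` / `ColourTrace.TrOrthonormal` (definitions asserting nothing),
Hermiticity of the generators, or `N ≠ 0`, and every conclusion is kernel-proved here from `Beta.ColourTrace`'s proved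
identities; NOTHING is cited as a fact.  Printed CONTEXT for the conventions is exactly that of `Beta.ColourTrace`'s citation
header (B9 p. 391–392: Hermitian 𝔤, normalised trace, transport `exp(iηA)` ⟹ letters `t = i·τ`; B12 (0.2), p. 289 ⟹ `Tr τ_aτ_b = N·δ_ab`),
read there as images; no page is re-opened here.

WHY A NEW LEAF.  `Beta.ColourTraceWeights` (v1.3) is now imported by `Beta.PlaquetteVertex2Trace` (an3), so by the cell's
olean rule it is frozen for appends; `Beta.ColourTrace` underlies the whole one-loop table tower.  This leaf imports
`Beta.ColourTrace` ONLY, touches no declaration there, and is imported by nothing until a consumer chooses to.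

WHAT IS DERIVED (every declaration `[folklore]`; no `axiom`, no `sorry`).  Throughout `τ : C → Mat_N(ℂ)`, letters `t_c := I•τ_c`
(an3's `PlaquetteVertex.gen τ c` is this by `rfl`), `adMatC τ X c d = tr(τ_c · i[X, τ_d])` and `adMat = Re adMatC` as in
`ColourTrace` §1/§3.
* §1 NO-HYPOTHESIS FACTS (any family, any `X`): the diagonal of `adMatC τ X` vanishes (`adMatC_diag`, from the cyclicity
  antisymmetry `ColourTrace.adMatC_antisymm`), hence **`trace_adMatC_eq_zero : (adMatC τ X).trace = 0`** and
  **`trace_adMat_eq_zero : (adMat τ X).trace = 0`** — `tr_C(ad X) = 0` for EVERY colour letter or word `X` (in particular for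
  `X ∝ [t_c, t_{c′}]`: the tadpole block with colour matrix `ad[t_c,t_{c′}]` carries weight `0`); the order of two adjoint
  matrices under the trace is immaterial (`trace_adMatC_mul_comm`, `trace_adMat_mul_comm`); `adMatC` is additive and
  ℂ-homogeneous in `X` (`adMatC_add`, `adMatC_smul`, `adMatC_sum`) — so `ad` of a field `W = Σ_c w_c t_c` is `Σ_c w_c • ad t_c`
  at the matrix level.
* §2 THE LETTER-BASIS READING (complete family, `N ≠ 0`): **`letter_comm_eq_sum : [I•X, t_d] = Σ_a adMatC τ X a d • t_a`** for
  every `X` — the colour matrix of `ad(I•X)` in the REAL basis of letters is `adMatC τ X`, column `d` = coordinates of the image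
  of `t_d` (from `ColourTrace.ibr_gen_eq_sum`); generator instance **`letter_comm_gen_eq_sum : [t_c, t_d] = Σ_a adMatC τ (τ c) a d • t_a`**,
  and for Hermitian generators with the REAL matrix: `letter_comm_gen_eq_sum_real : [t_c, t_d] = Σ_a (adMat τ (τ c) a d : ℝ) • t_a`
  (`ColourTrace.adMat_coe`).  So a «colourless table ⊗ ad t_c» bookkeeping reads entry for entry on `adMat τ (τ c)`, whose
  transpose is its negative (`ColourTrace.adMat_transpose`).
* §3 THE NAMED WEIGHTS (complete + tr-orthonormal, `N ≠ 0`; one theorem per colour matrix `C_i` of the consumer's list):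
  the bubble weight `trace(adMatC τ (τ c) · adMatC τ (τ c′)) = −[c = c′]·2N²` IS `ColourTrace.trace_adMatC_gen` /
  `ColourTrace.trace_adMat_gen` (real form) — cited BY NAME, not restated (gate dedup rule); NEW here: `weight_ad_mul_ad_swap`
  (the reversed product `ad t_{c′}·ad t_c`, same value) and `weight_ad_mul_ad_swap_real`, and `weight_ad_comm :
  trace(adMatC τ (I•[τ_c, τ_{c′}])) = 0` (the colour matrix `ad[t_c,t_{c′}]`; any scalar multiple, any bracket: §1).  The SIGN: `−2N²` is the
  sign of the Killing form on the compact real form (`ColourTrace.trace_adMatC_mul_eq_neg_killingForm`); the adjoint-Casimir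
  bracketing `Σ_a [t_a,[t_a,·]]` carries `+2N²` on traceless letters (`ColourTraceWeights` §8 `sum_ad_letter_sq`), the seagull
  bracketing `Σ_a [t_a,X][t_a,Y]` the sign of `trace(adMatC X · adMatC Y)` (`ColourTraceWeights` §7) — three bracketings, one
  magnitude.
* §4 `N = 2` CHECKS on the Pauli family of `ColourTrace` §6 by direct computation (no general theorem used):
  `trace(adMatC pauli (pauli c)) = 0` for each `c` (`pauli_trace_adMatC`), and the letter-basis reading at `(c, d) = (0, 1)`:
  `[iσ₁, iσ₂] = −2·(iσ₃)` against column `1` of `adMatC pauli (pauli 0)` = `(0, 0, −2)`.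

References: none cited (all [folklore]); context as in `Beta.ColourTrace`.  Cell records: journal FINDING F-an2g8-1 /
lit1-g20 ACK + CLAIM BETA-lit1-g20-ADJOINT-TRACE; GAPS C-lit1g20-2.
-/

namespace Literature.MathematicalPhysics.QuantumFieldTheory.Balaban1983to89.Beta.ColourTraceAdjoint

open Matrix Complex
open scoped BigOperators
open Literature.MathematicalPhysics.QuantumFieldTheory.Balaban1983to89.Beta.ColourTrace

variable {N : ℕ} {C : Type*} [Fintype C]

/-! ## §1 No-hypothesis facts: zero diagonal, zero trace, linearity -/

omit [Fintype C] in
/-- the diagonal of an adjoint-action matrix vanishes (cyclicity of the trace; no hypothesis on `τ` or `X`). [folklore] -/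
theorem adMatC_diag (τ : C → Matrix (Fin N) (Fin N) ℂ) (X : Matrix (Fin N) (Fin N) ℂ) (c : C) : adMatC τ X c c = 0 :=
  CharZero.eq_neg_self_iff.mp (adMatC_antisymm τ X c c)

omit [Fintype C] in
/-- … and so does the diagonal of its real part. [folklore] -/
theorem adMat_diag (τ : C → Matrix (Fin N) (Fin N) ℂ) (X : Matrix (Fin N) (Fin N) ℂ) (c : C) : adMat τ X c c = 0 := by
  rw [adMat_apply, adMatC_diag, Complex.zero_re]

/-- **`tr_C(ad X) = 0`** for EVERY `X`: `trace(adMatC τ X) = 0` (no hypothesis on the family or on `X`). [folklore] -/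
theorem trace_adMatC_eq_zero (τ : C → Matrix (Fin N) (Fin N) ℂ) (X : Matrix (Fin N) (Fin N) ℂ) : (adMatC τ X).trace = 0 := by
  simp [Matrix.trace, adMatC_diag]

/-- real form: `trace(adMat τ X) = 0` for every `X`. [folklore] -/
theorem trace_adMat_eq_zero (τ : C → Matrix (Fin N) (Fin N) ℂ) (X : Matrix (Fin N) (Fin N) ℂ) : (adMat τ X).trace = 0 := by
  simp [Matrix.trace, adMat_diag]

/-- the order of two adjoint matrices under the colour trace is immaterial. [folklore] -/
theorem trace_adMatC_mul_comm (τ : C → Matrix (Fin N) (Fin N) ℂ) (X Y : Matrix (Fin N) (Fin N) ℂ) :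
    (adMatC τ X * adMatC τ Y).trace = (adMatC τ Y * adMatC τ X).trace :=
  Matrix.trace_mul_comm _ _

/-- real form of the previous lemma. [folklore] -/
theorem trace_adMat_mul_comm (τ : C → Matrix (Fin N) (Fin N) ℂ) (X Y : Matrix (Fin N) (Fin N) ℂ) :
    (adMat τ X * adMat τ Y).trace = (adMat τ Y * adMat τ X).trace :=
  Matrix.trace_mul_comm _ _

omit [Fintype C] in
/-- `adMatC` is additive in `X`. [folklore] -/
theorem adMatC_add (τ : C → Matrix (Fin N) (Fin N) ℂ) (X Y : Matrix (Fin N) (Fin N) ℂ) :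
    adMatC τ (X + Y) = adMatC τ X + adMatC τ Y := by
  ext c d
  simp only [Matrix.add_apply, adMatC_apply, Matrix.mul_add, Matrix.add_mul, Matrix.trace_add, Matrix.trace_sub,
    Matrix.sub_mul]
  ring

omit [Fintype C] in
/-- `adMatC` is ℂ-homogeneous in `X`. [folklore] -/
theorem adMatC_smul (τ : C → Matrix (Fin N) (Fin N) ℂ) (z : ℂ) (X : Matrix (Fin N) (Fin N) ℂ) :
    adMatC τ (z • X) = z • adMatC τ X := by
  ext c d
  simp only [Matrix.smul_apply, adMatC_apply, Matrix.mul_smul, Matrix.smul_mul, Matrix.trace_smul, Matrix.trace_sub,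
    Matrix.sub_mul, smul_eq_mul]
  ring

omit [Fintype C] in
/-- `adMatC` of a finite linear combination: `adMatC τ (Σ_k w_k • X_k) = Σ_k w_k • adMatC τ (X_k)` — `ad` of a field expanded in
letters is the same combination of the `ad`'s of the letters. [folklore] -/
theorem adMatC_sum {K : Type*} (s : Finset K) (τ : C → Matrix (Fin N) (Fin N) ℂ) (w : K → ℂ)
    (X : K → Matrix (Fin N) (Fin N) ℂ) : adMatC τ (∑ k ∈ s, w k • X k) = ∑ k ∈ s, w k • adMatC τ (X k) := by
  classical
  induction s using Finset.induction_on with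
  | empty =>
    ext c d
    simp [adMatC_apply]
  | insert k s hk ih => rw [Finset.sum_insert hk, Finset.sum_insert hk, adMatC_add, adMatC_smul, ih]

/-! ## §2 The letter-basis reading of `ad` (complete family, `N ≠ 0`) -/

/-- **THE LETTER-BASIS READING** for every `X`: `[I•X, t_d] = Σ_a adMatC τ X a d • t_a` with `t_a = I•τ_a` — the colour
matrix of `ad(I•X)` in the real basis of letters is `adMatC τ X` (column `d` = the coordinates of the image of `t_d`). [folklore] -/
theorem letter_comm_eq_sum {τ : C → Matrix (Fin N) (Fin N) ℂ} (hτ : Complete τ) (hN : N ≠ 0)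
    (X : Matrix (Fin N) (Fin N) ℂ) (d : C) :
    (Complex.I • X) * (Complex.I • τ d) - (Complex.I • τ d) * (Complex.I • X) = ∑ a, adMatC τ X a d • (Complex.I • τ a) := by
  have h1 : (Complex.I • X) * (Complex.I • τ d) - (Complex.I • τ d) * (Complex.I • X) = Complex.I • ibr X (τ d) := by
    rw [ibr, Matrix.smul_mul, Matrix.mul_smul, smul_smul, Matrix.smul_mul, Matrix.mul_smul, smul_smul, smul_smul, ← smul_sub]
  rw [h1, ibr_gen_eq_sum hτ hN X d, Finset.smul_sum]
  refine Finset.sum_congr rfl fun a _ => ?_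
  rw [smul_smul, smul_smul, mul_comm]

/-- generator instance: **`[t_c, t_d] = Σ_a adMatC τ (τ c) a d • t_a`** — the colour matrix of `ad t_c` in the letter basis is
`adMatC τ (τ c)`. [folklore] -/
theorem letter_comm_gen_eq_sum {τ : C → Matrix (Fin N) (Fin N) ℂ} (hτ : Complete τ) (hN : N ≠ 0) (c d : C) :
    (Complex.I • τ c) * (Complex.I • τ d) - (Complex.I • τ d) * (Complex.I • τ c)
      = ∑ a, adMatC τ (τ c) a d • (Complex.I • τ a) :=
  letter_comm_eq_sum hτ hN (τ c) d

/-- Hermitian generators: the coefficients are the REAL matrix `adMat τ (τ c)` — `[t_c, t_d] = Σ_a (adMat τ (τ c) a d : ℝ) • t_a`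
(real scalars coerced to `ℂ`). [folklore] -/
theorem letter_comm_gen_eq_sum_real {τ : C → Matrix (Fin N) (Fin N) ℂ} (hτ : Complete τ) (hH : ∀ c, (τ c).IsHermitian)
    (hN : N ≠ 0) (c d : C) :
    (Complex.I • τ c) * (Complex.I • τ d) - (Complex.I • τ d) * (Complex.I • τ c)
      = ∑ a, ((adMat τ (τ c) a d : ℝ) : ℂ) • (Complex.I • τ a) := by
  rw [letter_comm_gen_eq_sum hτ hN]
  refine Finset.sum_congr rfl fun a _ => ?_
  rw [adMat_coe hH (hH c)]

/-! ## §3 The named weights of the consumer's colour matrices -/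

/-- **THE BUBBLE WEIGHT** `tr_C(ad t_c · ad t_{c′}) = −[c = c′]·2N²` — the ONE real weight of a colour-blind bubble against two
true first-order vertices `S ⊗ ad t_c`, `S′ ⊗ ad t_{c′}` — IS `ColourTrace.trace_adMatC_gen` (complex form) /
`ColourTrace.trace_adMat_gen` (real form, Hermitian generators), cited BY NAME and not restated here (dedup rule of the gate);
this lemma records that the reversed product `tr_C(ad t_{c′} · ad t_c)` has the same value `−[c = c′]·2N²`. [folklore] -/
theorem weight_ad_mul_ad_swap [DecidableEq C] {τ : C → Matrix (Fin N) (Fin N) ℂ} (hτ : Complete τ) (ho : TrOrthonormal τ)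
    (hN : N ≠ 0) (c c' : C) :
    (adMatC τ (τ c') * adMatC τ (τ c)).trace = if c = c' then -(2 * (N : ℂ) ^ 2) else 0 := by
  rw [trace_adMatC_mul_comm, trace_adMatC_gen hτ ho hN]

/-- real form, reversed product, Hermitian generators: `trace(adMat τ (τ c′) · adMat τ (τ c)) = −[c = c′]·2N²` in `ℝ`
(the direct order is `ColourTrace.trace_adMat_gen`). [folklore] -/
theorem weight_ad_mul_ad_swap_real [DecidableEq C] {τ : C → Matrix (Fin N) (Fin N) ℂ} (hτ : Complete τ)
    (ho : TrOrthonormal τ) (hH : ∀ c, (τ c).IsHermitian) (hN : N ≠ 0) (c c' : C) :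
    (adMat τ (τ c') * adMat τ (τ c)).trace = if c = c' then -(2 * (N : ℝ) ^ 2) else 0 := by
  rw [trace_adMat_mul_comm, trace_adMat_gen hτ ho hH hN]

omit [Fintype C] in
/-- the letter commutator as `I •` a matrix: `[t_c, t_{c′}] = I • (I • (τ_c τ_{c′} − τ_{c′} τ_c))` rewritten, i.e.
`[t_c, t_{c′}] = −[τ_c, τ_{c′}]`. [folklore] -/
theorem letter_comm_eq_neg (τ : C → Matrix (Fin N) (Fin N) ℂ) (c c' : C) :
    (Complex.I • τ c) * (Complex.I • τ c') - (Complex.I • τ c') * (Complex.I • τ c) = -(τ c * τ c' - τ c' * τ c) := by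
  rw [Matrix.smul_mul, Matrix.mul_smul, smul_smul, Matrix.smul_mul, Matrix.mul_smul, smul_smul, ← smul_sub,
    Complex.I_mul_I, neg_one_smul]

/-- **THE COMMUTATOR TADPOLE WEIGHT IS ZERO**: for the colour matrix `ad Z` of ANY `Z` — in particular `Z = [t_c, t_{c′}] = I•X` with
`X = I•[τ_c, τ_{c′}]` — `trace(adMatC τ X) = 0`; stated at the bracket so that the consumer's `C = ad[t_c,t_{c′}]` has its own
name. [folklore] -/
theorem weight_ad_comm (τ : C → Matrix (Fin N) (Fin N) ℂ) (c c' : C) :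
    (adMatC τ (Complex.I • (τ c * τ c' - τ c' * τ c))).trace = 0 :=
  trace_adMatC_eq_zero τ _

/-! ## §4 `N = 2` checks on the Pauli family (direct computation, no general theorem) -/

/-- `trace(adMatC pauli (pauli c)) = 0` for each Pauli generator, by computing the three diagonal entries. [folklore] -/
theorem pauli_trace_adMatC (c : Fin 3) : (adMatC pauli (pauli c)).trace = 0 := by
  fin_cases c <;>
    simp [Matrix.trace, Fin.sum_univ_three, adMatC_apply, pauli, Fin.sum_univ_two]

/-- the letter-basis reading at `N = 2`, `(c, d) = (0, 1)`: `[iσ₁, iσ₂] = −[σ₁, σ₂] = −2iσ₃`, i.e. the coefficient vector of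
`[t_0, t_1]` in the letters is `(0, 0, −2)`. [folklore] -/
example : (Complex.I • pauli 0) * (Complex.I • pauli 1) - (Complex.I • pauli 1) * (Complex.I • pauli 0)
    = (-2 : ℂ) • (Complex.I • pauli 2) := by
  ext i j
  fin_cases i <;> fin_cases j <;> simp [pauli] <;> ring

/-- … and the column `d = 1` of `adMatC pauli (pauli 0)` is `(0, 0, −2)`: entry `a = 2`. [folklore] -/
example : adMatC pauli (pauli 0) 2 1 = -2 := by
  simp [adMatC_apply, pauli, Matrix.trace, Fin.sum_univ_two]
  linear_combination (2 : ℂ) * Complex.I_mul_I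

/-- … entries `a = 0, 1` of that column vanish. [folklore] -/
example : adMatC pauli (pauli 0) 0 1 = 0 ∧ adMatC pauli (pauli 0) 1 1 = 0 := by
  constructor <;> simp [adMatC_apply, pauli, Matrix.trace, Fin.sum_univ_two]

end Literature.MathematicalPhysics.QuantumFieldTheory.Balaban1983to89.Beta.ColourTraceAdjoint
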